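import Summits.HodgeConjecture.HodgeConjecture.Theorems.HodgeLocusCensusValJ0At3

/-!
# Hodge locus census — V3-XT, N = 1: the 7-RAMIFIED census of `j + 3375` and the quadratic twists of `X₀(49)` (engine A, abs-1 gen 27, ROW 7)

HONEST FRAMING: certified instances and evidence bearing on the general Hodge conjecture; no claim.

Setting (THEOREM R7, `pub-hlocus-abs-1/g27/DERIVATION-R7-A.md` of the pub-hlocus cell).  `D ∈ {-7m, -28m}`, `m` squarefree,
`7 ∤ m`; `E` with CM by `O_D`; `𝔓` a prime of the ring class field above `7`, `v_𝔓(7) = 2`.  In characteristic `7` the only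
supersingular invariant is `j ≡ -3375 ≡ 1728`, with endomorphism ring the maximal order `O = ℤ⟨1, i, (1+j)/2, (i+k)/2⟩` of
`B = (-1,-7)_ℚ` (`O^× = {±1, ±i}`).  A class `C ∈ Cl(D)` is an `⟨i⟩`-orbit `{(b', c, d), (b', -c, -d)}` of primitive admissible
vectors `y = 7b'·i + c·j + d·k`, `7b'² + c² + d² = M := |D|/7`, `c ≡ D (mod 2)`, `b' ≡ d (mod 2)` (two vectors per class:
CHECKED, `#vectors = 2 h(D)` for every discriminant of the census, DERIVATION-R7-A.md §6), and the DERIVED valuation law (Gross's ramified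
length at level `0`, [cite: KudlaRapoportYang2006, (3.6.11)–(3.6.12)], multiplicity ONE because `(1 ± j)/2` generate the only
copy of `O_{-7}` in `O`) is

  `v_𝔓(j(C) + 3375) = vLaw7 b' d := 2 + v₇(7b'² + d²) = 2 + v₇(M - c²)`,   Newton slope `1 + v₇(M - c²)/2`.

The census (kit jobs of the cell, PARI `polclass` + `newtonpoly` against `factorpadic`, against the vector law, against the
theta dictionary below) certifies this class by class.  DICTIONARY (`Θ₇ = x² + xy + 2y²`, `r(m; Q) = #{Q = m}`,
`ν'_t(D) = #{C : slope ≥ 1 + t/2}`):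

  `2 ν'_t(-7m) = r(m; c² + 4·7^t Θ₇)` (`m ≡ 1 (4)`),   `2 ν'_t(-28m) = r(m; c² + 7^t Θ₇) - [m ≡ 1 (4)]·r(m; c² + 4·7^t Θ₇)`.

THEOREM R7 (with Lehman's weight-3/2 forms `g'θ₂₈ = Σ aₙqⁿ`, `h'θ₁₄ = Σ bₙqⁿ` [cite: Lehman1987, Thm 2] and Sturm-proved theta
identities): for squarefree `m > 1`, `7 ∤ m`, `(m/7) = +1`, `K = ℚ(√-7m)`, `h = h_K`, `ν = #{C ∈ Cl_K : v_𝔓(j(C)+3375) ≥ 3}`: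
`a_m = 2ν - h/2` (`m ≡ 1 (4)`), `b_m = ν - h/4` (`m ≡ 2, 3 (4)`), hence `L(E^{(m)}, 1) = 0 ⟺ ν = h/4` (`E = X₀(49)`), and
numerically (certified) `L(E^{(m)},1)/ω₁(E^{(m)}) = (4ν - h)²/8` in both cases; for `(m/7) = -1` every class has `v_𝔓 = 2`.
Contents (finite algebraic core only; the modular input is NOT formalised):
* `vLaw7`, `lgW_seven_level_zero_ramified`, `vLaw7_eq_lgW` — the law and its Gross-length bookkeeping (`lgW` of ROW 2);
* `seven_dvd_b`, `depth_ge_iff`, `vLaw7_eq_two_of_not_dvd`, `squares_mod_seven`, `vLaw7_eq_two_of_nonresidue` — residue analysis,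
  in particular the NEGATIVE side: `M` a non-residue mod `7` forces `v_𝔓 = 2` for every class;
* `seven_dvd_of_norm`, `sqrt_neg_seven_step`, `step_parity`, `seven_pow_step` — the `(√-7)`-adic descent in `ℤ[√-7]`;
* `kleinian_norm_four`, `same_parity_of_norm`, `norm_of_same_parity`, `dictionary_substitution`, `dictionary_substitution_even`,
  `theta_box` — the passage from same-parity pairs to `O_K = ℤ[(1+√-7)/2]` that produces the ternary forms `c² + 4·7^tΘ₇`, `c² + 7^tΘ₇`,
  and the completeness of the enumeration boxes;
* `anchor_29`, `anchor_53`, `anchor_11`, `anchor_23` — ternary counts by `decide` (`m = 29, 53`: `h = 4, 8`, `ν = 2, 2`, `a = 2, 0`;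
  `m = 11, 23`: `h = 8, 16`, `ν = 2, 6`, `b = 0, 2`; `L = 0` exactly for `53` and `11`, as in [cite: Lehman1987, Table I]);
* `levels`, `sturm_numerals` — level / index / bound bookkeeping of the Sturm arguments (`784 → 1344 → 168`; `3136 → 672`;
  `Γ₁(12544) → 14 450 688 < 1.6·10⁷`);
* `R7_assembly_odd`, `R7_assembly_even`, `a_even_of_four_dvd`, `R7_conductor_two` — the arithmetic of THEOREM R7.

politeness: helper file, `lean check` rc 0, 0 sorries, no new axioms.
-/

namespace Summit.HodgeConjecture.HodgeConjecture.HodgeLocus.Census.Ramified7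

open Summit.HodgeConjecture.HodgeConjecture.HodgeLocus.Census.ValJ0At3 (lgW)

/-! ### The law -/

/-- The valuation law on an admissible vector `y = 7b'·i + c·j + d·k` (`7b'² + c² + d² = M = |D|/7`):
`v_𝔓(j + 3375) = 2 + v₇(7b'² + d²)` (`v_𝔓(7) = 2`); `c` enters only through the constraint. [derived: DERIVATION-R7-A §2] -/
def vLaw7 (b' d : ℕ) : ℕ := 2 + padicValNat 7 (7 * b' ^ 2 + d ^ 2)

/-- At level `0` with `k = ℚ₇(√-7)` ramified (`e₀ = 2`) the Gross length is `a + 1`. [cite: KudlaRapoportYang2006, (3.6.11)–(3.6.12)] -/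
theorem lgW_seven_level_zero_ramified (a : ℚ) : lgW 7 0 a 2 = a + 1 := by
  simp only [lgW]
  norm_num

/-- Dictionary with the length: `vLaw7 b' d = 1 · lg(W_k/I_ℓ)` with `ℓ = 1 + v₇(7b'² + d²)` — multiplicity ONE of the
canonical-lift divisor in `div(j + 3375)` (contrast `3·` at `j = 0`, ROW 2). -/
theorem vLaw7_eq_lgW (b' d : ℕ) :
    (vLaw7 b' d : ℚ) = lgW 7 0 (1 + padicValNat 7 (7 * b' ^ 2 + d ^ 2)) 2 := by
  rw [lgW_seven_level_zero_ramified]; simp [vLaw7]; ring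

/-! ### Residue analysis -/

/-- A trace-zero element `b i + c j + d k` of `B = (-1,-7)` has norm `b² + 7c² + 7d²`; if this is `|D| = 7M` then `7 ∣ b`. -/
theorem seven_dvd_b {b c d M : ℕ} (h : b ^ 2 + 7 * c ^ 2 + 7 * d ^ 2 = 7 * M) : 7 ∣ b := by
  have h1 : 7 ∣ 7 * (c ^ 2 + d ^ 2) + b ^ 2 := ⟨M, by linarith⟩
  have h7 : 7 ∣ b ^ 2 := (Nat.dvd_add_right (dvd_mul_right 7 _)).mp h1
  exact Nat.Prime.dvd_of_dvd_pow (by norm_num : Nat.Prime 7) h7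

/-- With `b = 7b'` the constraint reads `7b'² + c² + d² = M`. -/
theorem constraint_reduced {b' c d M : ℕ} (h : (7 * b') ^ 2 + 7 * c ^ 2 + 7 * d ^ 2 = 7 * M) :
    7 * b' ^ 2 + c ^ 2 + d ^ 2 = M := by
  nlinarith [h]

/-- Depth threshold: slope `≥ 1 + t/2`, i.e. `v_𝔓 ≥ 2 + t`, iff `7^t ∣ 7b'² + d²`. -/
theorem depth_ge_iff {b' d t : ℕ} (hne : 7 * b' ^ 2 + d ^ 2 ≠ 0) :
    2 + t ≤ vLaw7 b' d ↔ 7 ^ t ∣ 7 * b' ^ 2 + d ^ 2 := by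
  have h7 : Fact (Nat.Prime 7) := ⟨by norm_num⟩
  rw [vLaw7, padicValNat_dvd_iff_le hne]
  omega

/-- `7 ∤ d ⇒ v_𝔓 = 2` (slope `1`). -/
theorem vLaw7_eq_two_of_not_dvd {b' d : ℕ} (hd : ¬ 7 ∣ d) : vLaw7 b' d = 2 := by
  have hnd : ¬ 7 ∣ 7 * b' ^ 2 + d ^ 2 := by
    intro h
    have : 7 ∣ d ^ 2 := (Nat.dvd_add_right (dvd_mul_right 7 _)).mp h
    exact hd (Nat.Prime.dvd_of_dvd_pow (by norm_num) this)
  simp [vLaw7, padicValNat.eq_zero_of_not_dvd hnd]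

/-- The squares mod `7` are `0, 1, 2, 4`; `3, 5, 6` are the non-residues. [decide] -/
theorem squares_mod_seven : ∀ x : ZMod 7, x ^ 2 = 0 ∨ x ^ 2 = 1 ∨ x ^ 2 = 2 ∨ x ^ 2 = 4 := by decide

/-- NEGATIVE SIDE ((m/7) = -1): if `M = 7b'² + c² + d²` is a non-residue mod `7`, then `7 ∤ d` for every admissible vector
(else `M ≡ c²`), hence `v_𝔓(j(C) + 3375) = 2` for every class — the census is trivial, as certified (all slopes `1`
on the four `(m/7) = -1` families). -/
theorem vLaw7_eq_two_of_nonresidue {b' c d M : ℕ} (h : 7 * b' ^ 2 + c ^ 2 + d ^ 2 = M)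
    (hM : M % 7 = 3 ∨ M % 7 = 5 ∨ M % 7 = 6) : vLaw7 b' d = 2 := by
  apply vLaw7_eq_two_of_not_dvd
  intro hd
  have key : ∀ x y : ZMod 7, y = 0 → (x ^ 2 + y ^ 2 = 3 ∨ x ^ 2 + y ^ 2 = 5 ∨ x ^ 2 + y ^ 2 = 6) → False := by decide
  have hc : ((c : ZMod 7)) ^ 2 + ((d : ZMod 7)) ^ 2 = ((M % 7 : ℕ) : ZMod 7) := by
    have e : ((7 * b' ^ 2 + c ^ 2 + d ^ 2 : ℕ) : ZMod 7) = ((M : ℕ) : ZMod 7) := by rw [h]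
    push_cast at e
    have h7 : (7 : ZMod 7) = 0 := by decide
    rw [h7, zero_mul, zero_add] at e
    rw [e, ZMod.natCast_mod]
  have hd0 : ((d : ZMod 7)) = 0 := (ZMod.natCast_eq_zero_iff d 7).mpr hd
  rcases hM with hM | hM | hM <;> rw [hM] at hc
  · have hc' : ((c : ZMod 7)) ^ 2 + ((d : ZMod 7)) ^ 2 = 3 := by exact_mod_cast hc
    exact key _ _ hd0 (Or.inl hc')
  · have hc' : ((c : ZMod 7)) ^ 2 + ((d : ZMod 7)) ^ 2 = 5 := by exact_mod_cast hc
    exact key _ _ hd0 (Or.inr (Or.inl hc'))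
  · have hc' : ((c : ZMod 7)) ^ 2 + ((d : ZMod 7)) ^ 2 = 6 := by exact_mod_cast hc
    exact key _ _ hd0 (Or.inr (Or.inr hc'))

/-! ### The `(√-7)`-adic descent in `ℤ[√-7]` -/

/-- `7 ∣ d² + 7b'²` forces `7 ∣ d`. -/
theorem seven_dvd_of_norm {d b' : ℤ} (h : (7 : ℤ) ∣ d ^ 2 + 7 * b' ^ 2) : 7 ∣ d := by
  have h1 : (7 : ℤ) ∣ d ^ 2 := by
    have : (7 : ℤ) ∣ 7 * b' ^ 2 := dvd_mul_right 7 _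
    exact (dvd_add_left this).mp h
  exact Int.Prime.dvd_pow' (by norm_num) h1

/-- The step: dividing `d + b'√-7` by `√-7` gives `b' - d'√-7` (`d = 7d'`), of norm one seventh. -/
theorem sqrt_neg_seven_step (d' b' : ℤ) :
    (7 * d') ^ 2 + 7 * b' ^ 2 = 7 * (b' ^ 2 + 7 * d' ^ 2) := by ring

/-- The step preserves the parity relation `d ≡ b' (mod 2)`. -/
theorem step_parity (d' b' : ℤ) : (2 : ℤ) ∣ 7 * d' - b' ↔ 2 ∣ b' - d' := by
  constructor
  · rintro ⟨k, hk⟩; exact ⟨3 * d' - k, by linarith⟩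
  · rintro ⟨k, hk⟩; exact ⟨3 * d' - k, by linarith⟩

/-- One level up: `7^(t+1) ∣ d² + 7b'²` iff `7 ∣ d` and `7^t` divides the norm of the descended pair. -/
theorem seven_pow_step (d b' : ℤ) (t : ℕ) :
    (7 : ℤ) ^ (t + 1) ∣ d ^ 2 + 7 * b' ^ 2 ↔
      ∃ d' : ℤ, d = 7 * d' ∧ (7 : ℤ) ^ t ∣ b' ^ 2 + 7 * d' ^ 2 := by
  constructor
  · intro h
    have h7 : (7 : ℤ) ∣ d ^ 2 + 7 * b' ^ 2 := (dvd_pow_self 7 (Nat.succ_ne_zero t)).trans h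
    obtain ⟨d', rfl⟩ := seven_dvd_of_norm h7
    refine ⟨d', rfl, ?_⟩
    rw [sqrt_neg_seven_step, pow_succ'] at h
    exact (mul_dvd_mul_iff_left (by norm_num : (7 : ℤ) ≠ 0)).mp h
  · rintro ⟨d', rfl, h⟩
    rw [sqrt_neg_seven_step, pow_succ']
    exact mul_dvd_mul_left 7 h

/-! ### Same-parity pairs and `O_K = ℤ[(1+√-7)/2]` -/

/-- `4 (x² + xy + 2y²) = (2x + y)² + 7y²`: the norm form `Θ₇` of `O_K` versus that of `ℤ[√-7]`. -/
theorem kleinian_norm_four (x y : ℤ) : 4 * (x ^ 2 + x * y + 2 * y ^ 2) = (2 * x + y) ^ 2 + 7 * y ^ 2 := by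
  ring

/-- A pair `(X, Y)` with `4 ∣ X² + 7Y²` has `X ≡ Y (mod 2)`. [residues mod 4] -/
theorem same_parity_of_norm {X Y : ℤ} (h : (4 : ℤ) ∣ X ^ 2 + 7 * Y ^ 2) : 2 ∣ X - Y := by
  rcases Int.even_or_odd X with ⟨a, ha⟩ | hX <;> rcases Int.even_or_odd Y with ⟨b, hb⟩ | hY
  · exact ⟨a - b, by omega⟩
  · exfalso
    have hY2 : Y ^ 2 % 4 = 1 := Int.sq_mod_four_eq_one_of_odd hY
    have hX2 : X ^ 2 = 4 * a ^ 2 := by rw [ha]; ring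
    obtain ⟨t, ht⟩ := h
    generalize X ^ 2 = U at *
    generalize Y ^ 2 = V at *
    generalize a ^ 2 = W at *
    omega
  · exfalso
    have hX2 : X ^ 2 % 4 = 1 := Int.sq_mod_four_eq_one_of_odd hX
    have hY2 : Y ^ 2 = 4 * b ^ 2 := by rw [hb]; ring
    obtain ⟨t, ht⟩ := h
    generalize X ^ 2 = U at *
    generalize Y ^ 2 = V at *
    generalize b ^ 2 = W at *
    omega
  · obtain ⟨a, ha⟩ := hX
    obtain ⟨b, hb⟩ := hY
    exact ⟨a - b, by omega⟩

/-- Conversely a same-parity pair is `X = 2x + Y` with `x = (X - Y)/2`, and `X² + 7Y² = 4 Θ₇(x, Y)`. -/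
theorem norm_of_same_parity {X Y : ℤ} (h : (2 : ℤ) ∣ X - Y) :
    ∃ x : ℤ, X = 2 * x + Y ∧ X ^ 2 + 7 * Y ^ 2 = 4 * (x ^ 2 + x * Y + 2 * Y ^ 2) := by
  obtain ⟨k, hk⟩ := h
  exact ⟨k, by linarith, by rw [show X = 2 * k + Y by linarith]; ring⟩

/-- Dictionary, odd discriminant `D = -7m` (`c` odd, `M = m`): a vector at depth level `t` — `d² + 7b'² = 7^t·N` with descended
same-parity pair `(X, Y)`, `N = X² + 7Y²`, `X = 2x + Y` — is a representation of `m` by `c² + 4·7^t·Θ₇`. [bookkeeping over ℤ] -/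
theorem dictionary_substitution {m c d b' X Y x : ℤ} {t : ℕ}
    (hM : c ^ 2 + (d ^ 2 + 7 * b' ^ 2) = m) (hlev : d ^ 2 + 7 * b' ^ 2 = 7 ^ t * (X ^ 2 + 7 * Y ^ 2))
    (hx : X = 2 * x + Y) :
    c ^ 2 + 4 * 7 ^ t * (x ^ 2 + x * Y + 2 * Y ^ 2) = m := by
  subst hx
  rw [← hM, hlev]
  ring

/-- Dictionary, even discriminant `D = -28m` (`c = 2c₀`, `M = 4m`): the same vector gives a representation of `m` by
`c₀² + 7^t·Θ₇`; the non-primitive vectors (present iff `m ≡ 1 (4)`) are `2·`(vectors of `-7m`), whence the subtracted term. -/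
theorem dictionary_substitution_even {m c₀ d b' X Y x : ℤ} {t : ℕ}
    (hM : (2 * c₀) ^ 2 + (d ^ 2 + 7 * b' ^ 2) = 4 * m) (hlev : d ^ 2 + 7 * b' ^ 2 = 7 ^ t * (X ^ 2 + 7 * Y ^ 2))
    (hx : X = 2 * x + Y) :
    c₀ ^ 2 + 7 ^ t * (x ^ 2 + x * Y + 2 * Y ^ 2) = m := by
  subst hx
  have : 4 * (c₀ ^ 2 + 7 ^ t * (x ^ 2 + x * Y + 2 * Y ^ 2)) = 4 * m := by rw [← hM, hlev]; ring
  linarith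

/-- Completeness of enumeration boxes: `7y² ≤ 4Θ₇(x,y)` and `7x² ≤ 8Θ₇(x,y)`. -/
theorem theta_box (x y : ℤ) :
    7 * y ^ 2 ≤ 4 * (x ^ 2 + x * y + 2 * y ^ 2) ∧ 7 * x ^ 2 ≤ 8 * (x ^ 2 + x * y + 2 * y ^ 2) := by
  constructor
  · nlinarith [sq_nonneg (2 * x + y)]
  · nlinarith [sq_nonneg (x + 4 * y)]

/-! ### Anchors (ternary counts by `decide`; boxes complete by `theta_box` and `c² ≤ m`) -/

/-- `m = 29` (`D = -203`, `h = 4`): `r(29; c² + 4Θ₇) = 8 = 2h`, `r(29; c² + 28Θ₇) = 4 = 2ν`, so `ν = 2`, `a₂₉ = 2ν - h/2 = 2`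
([cite: Lehman1987, Table I]: `L(E^{(29)},1) ≠ 0`). -/
theorem anchor_29 :
    ((Finset.Icc (-6 : ℤ) 6 ×ˢ Finset.Icc (-3 : ℤ) 3 ×ˢ Finset.Icc (-3 : ℤ) 3).filter
        (fun p => p.1 ^ 2 + 4 * (p.2.1 ^ 2 + p.2.1 * p.2.2 + 2 * p.2.2 ^ 2) = 29)).card = 8 ∧
    ((Finset.Icc (-6 : ℤ) 6 ×ˢ Finset.Icc (-3 : ℤ) 3 ×ˢ Finset.Icc (-3 : ℤ) 3).filter
        (fun p => p.1 ^ 2 + 28 * (p.2.1 ^ 2 + p.2.1 * p.2.2 + 2 * p.2.2 ^ 2) = 29)).card = 4 := by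
  refine ⟨by decide +kernel, by decide +kernel⟩

/-- `m = 53` (`D = -371`, `h = 8`): counts `16 = 2h` and `4 = 2ν`, so `ν = 2 = h/4`, `a₅₃ = 0`: `L(E^{(53)},1) = 0`
([cite: Lehman1987, Table I]). -/
theorem anchor_53 :
    ((Finset.Icc (-8 : ℤ) 8 ×ˢ Finset.Icc (-4 : ℤ) 4 ×ˢ Finset.Icc (-3 : ℤ) 3).filter
        (fun p => p.1 ^ 2 + 4 * (p.2.1 ^ 2 + p.2.1 * p.2.2 + 2 * p.2.2 ^ 2) = 53)).card = 16 ∧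
    ((Finset.Icc (-8 : ℤ) 8 ×ˢ Finset.Icc (-4 : ℤ) 4 ×ˢ Finset.Icc (-3 : ℤ) 3).filter
        (fun p => p.1 ^ 2 + 28 * (p.2.1 ^ 2 + p.2.1 * p.2.2 + 2 * p.2.2 ^ 2) = 53)).card = 4 := by
  refine ⟨by decide +kernel, by decide +kernel⟩

/-- `m = 11` (`D = -308`, `h = 8`): `r(11; c² + Θ₇) = 16 = 2h`, `r(11; c² + 7Θ₇) = 4 = 2ν`, so `ν = 2 = h/4`, `b₁₁ = 0`:
`L(E^{(11)},1) = 0` ([cite: Lehman1987, Table I]). -/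
theorem anchor_11 :
    ((Finset.Icc (-4 : ℤ) 4 ×ˢ Finset.Icc (-4 : ℤ) 4 ×ˢ Finset.Icc (-3 : ℤ) 3).filter
        (fun p => p.1 ^ 2 + (p.2.1 ^ 2 + p.2.1 * p.2.2 + 2 * p.2.2 ^ 2) = 11)).card = 16 ∧
    ((Finset.Icc (-4 : ℤ) 4 ×ˢ Finset.Icc (-4 : ℤ) 4 ×ˢ Finset.Icc (-3 : ℤ) 3).filter
        (fun p => p.1 ^ 2 + 7 * (p.2.1 ^ 2 + p.2.1 * p.2.2 + 2 * p.2.2 ^ 2) = 11)).card = 4 := by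
  refine ⟨by decide +kernel, by decide +kernel⟩

/-- `m = 23` (`D = -644`, `h = 16`): counts `32 = 2h` and `12 = 2ν`, so `ν = 6`, `b₂₃ = ν - h/4 = 2`: `L(E^{(23)},1) ≠ 0`
([cite: Lehman1987, Table I]). -/
theorem anchor_23 :
    ((Finset.Icc (-5 : ℤ) 5 ×ˢ Finset.Icc (-6 : ℤ) 6 ×ˢ Finset.Icc (-4 : ℤ) 4).filter
        (fun p => p.1 ^ 2 + (p.2.1 ^ 2 + p.2.1 * p.2.2 + 2 * p.2.2 ^ 2) = 23)).card = 32 ∧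
    ((Finset.Icc (-5 : ℤ) 5 ×ˢ Finset.Icc (-6 : ℤ) 6 ×ˢ Finset.Icc (-4 : ℤ) 4).filter
        (fun p => p.1 ^ 2 + 7 * (p.2.1 ^ 2 + p.2.1 * p.2.2 + 2 * p.2.2 ^ 2) = 23)).card = 12 := by
  refine ⟨by decide +kernel, by decide +kernel⟩

/-- Normalisation of the anchors: two vectors per class and the coefficient formulas
`a = 2ν - h/2`, `b = ν - h/4` on `(m, h, 2ν) = (29,4,4), (53,8,4), (11,8,4), (23,16,12)`. [numerals] -/
theorem anchors_normalised :
    (2 * 2 - 4 / 2 : ℤ) = 2 ∧ (2 * 2 - 8 / 2 : ℤ) = 0 ∧ (2 - 8 / 4 : ℤ) = 0 ∧ (6 - 16 / 4 : ℤ) = 2 ∧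
    8 = 2 * 4 ∧ 16 = 2 * 8 ∧ 32 = 2 * 16 ∧ 12 = 2 * 6 := by norm_num

/-! ### Levels and the Sturm bookkeeping (DERIVATION-R7-A §4) -/

/-- Levels of the ternary theta series `θ(c² + s·Θ₇)`, `s = 4·7^t` resp. `7^t`: `28, 196` (`t = 0, 1`); all forms of the
identities lie in `M_{3/2}(784, χ₇)`, `784 = 16·49 = 4·196`; `−3375 − 1728 = −7·729` and `7 ∤ 3375` (so `j(C) ≡ 1728`, `v_𝔓(j(C)) = 0`). -/
theorem levels : 4 * 7 = 28 ∧ 4 * 49 = 196 ∧ 784 = 16 * 49 ∧ 784 = 4 * 196 ∧ Nat.lcm 28 (Nat.lcm 196 (Nat.lcm 392 784)) = 784 ∧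
    (3375 : ℤ) + 1728 = 7 * 729 ∧ 3375 % 7 = 1 ∧ 3375 = 15 ^ 3 := by
  refine ⟨by norm_num, by norm_num, by norm_num, by norm_num, by decide, by norm_num, by norm_num, by norm_num⟩

/-- Sturm bookkeeping.  Twists by `χ₋₄` (conductor `4`) and `(·/7)` (conductor `7`), `𝔣(χ₇) = 28`: the level stays
`lcm(784, 4², 4·28) = lcm(784, 7², 7·28) = 784`; conductor-`8` twists give `lcm(784, 8², 8·28) = 3136`.
`[SL₂(ℤ):Γ₀(784)] = 1344`, weight-`6` bound `672`, so `F = 0` once `F(n) = 0` for `n ≤ 168` (`4·169 > 672`);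
`[SL₂(ℤ):Γ₀(3136)] = 5376 → 2688 → 672`; the progression `n ≡ 2 (mod 4)` needs `Γ₁(784·4²) = Γ₁(12544)` of index
`12544²·(1 - 1/4)(1 - 1/49) = 115 605 504`, bound `57 802 752` for `F⁴`, `14 450 688` for `F`, below the verified `1.6·10⁷`. -/
theorem sturm_numerals :
    Nat.lcm 784 (Nat.lcm (4 ^ 2) (4 * 28)) = 784 ∧ Nat.lcm 784 (Nat.lcm (7 ^ 2) (7 * 28)) = 784 ∧
    Nat.lcm 784 (Nat.lcm (8 ^ 2) (8 * 28)) = 3136 ∧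
    784 / (2 * 7) * ((2 + 1) * (7 + 1)) = 1344 ∧ 6 * 1344 / 12 = 672 ∧ 672 < 4 * 169 ∧ 168 < 20000 ∧
    3136 / (2 * 7) * ((2 + 1) * (7 + 1)) = 5376 ∧ 6 * 5376 / 12 / 4 = 672 ∧ 672 < 20000 ∧
    12544 = 784 * 4 ^ 2 ∧ 12544 ^ 2 / (4 * 49) * (3 * 48) = 115605504 ∧ 6 * 115605504 / 12 = 57802752 ∧
    57802752 / 4 = 14450688 ∧ 14450688 < 16000000 := by
  refine ⟨by decide, by decide, by decide, ?_⟩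
  norm_num

/-- Support bookkeeping: the exponents of `g'θ₂₈` (`a² + b² + 28k²`, `a` odd, `b` even) are `≡ 1 (mod 4)`; the exponents of
`h'θ₁₄` (`a² + 2b² + 14k²`) are never `≡ 5 (mod 8)` when odd; `c² + 4Θ₇ ≢ 2, 3 (mod 4)`. [residues] -/
theorem support_residues :
    (∀ a b k : ZMod 4, a ^ 2 = 1 → (2 : ZMod 4) ∣ b → (a ^ 2 + b ^ 2 + 28 * k ^ 2) = 1) ∧
    (∀ a b k : ZMod 8, a ^ 2 + 2 * b ^ 2 + 14 * k ^ 2 ≠ 5) ∧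
    (∀ c x y : ZMod 4, c ^ 2 + 4 * (x ^ 2 + x * y + 2 * y ^ 2) ≠ 2 ∧ c ^ 2 + 4 * (x ^ 2 + x * y + 2 * y ^ 2) ≠ 3) := by
  refine ⟨by decide, by decide, by decide⟩

/-! ### Arithmetic of THEOREM R7 (DERIVATION-R7-A §5) -/

/-- Odd family `m ≡ 1 (mod 4)`: with `a = 2ν - h/2` (dictionary + identity ID7a) and the certified normalisation
`A := L(E^{(m)},1)/ω₁ = a²/2`, one has `A = (4ν - h)²/8` and `A = 0 ↔ 4ν = h`. -/
theorem R7_assembly_odd (h ν a A : ℚ) (ha : a = 2 * ν - h / 2) (hA : A = a ^ 2 / 2) :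
    A = (4 * ν - h) ^ 2 / 8 ∧ (A = 0 ↔ 4 * ν = h) := by
  subst ha
  refine ⟨by rw [hA]; ring, ?_⟩
  rw [hA]
  constructor
  · intro h0
    have : (2 * ν - h / 2) ^ 2 = 0 := by linarith
    have h1 : 2 * ν - h / 2 = 0 := pow_eq_zero_iff (n := 2) (by norm_num) |>.mp this
    linarith
  · intro h4
    have : 2 * ν - h / 2 = 0 := by linarith
    rw [this]; norm_num

/-- Even family `m ≡ 2, 3 (mod 4)`: with `b = ν - h/4` (dictionary + identity ID7b) and `A = 2b²`, again `A = (4ν - h)²/8`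
and `A = 0 ↔ 4ν = h` — the UNIFORM law. -/
theorem R7_assembly_even (h ν b A : ℚ) (hb : b = ν - h / 4) (hA : A = 2 * b ^ 2) :
    A = (4 * ν - h) ^ 2 / 8 ∧ (A = 0 ↔ 4 * ν = h) := by
  subst hb
  refine ⟨by rw [hA]; ring, ?_⟩
  rw [hA]
  constructor
  · intro h0
    have : (ν - h / 4) ^ 2 = 0 := by linarith
    have h1 : ν - h / 4 = 0 := pow_eq_zero_iff (n := 2) (by norm_num) |>.mp this
    linarith
  · intro h4
    have : ν - h / 4 = 0 := by linarith
    rw [this]; norm_num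

/-- Integrality: `2a = 4ν - h` with `a ∈ ℤ` forces `h` even, and `4 ∣ h` (genus theory / Rédei for `(m/7) = +1`) forces `a` even —
as in [cite: Lehman1987, Table I] (`a₂₉ = 2, a₆₅ = -2, a₉₃ = -4, a₁₇₇ = -8, a₂₃₃ = 6`); `4b = 4ν - h` forces `4 ∣ h`. -/
theorem a_even_of_four_dvd (h ν a b : ℤ) (ha : 2 * a = 4 * ν - h) (hb : 4 * b = 4 * ν - h) :
    (2 ∣ h) ∧ (4 ∣ h → 2 ∣ a) ∧ 4 ∣ h := by
  refine ⟨?_, ?_, ?_⟩ <;> omega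

/-- The conductor-`2` companion (R7-3), `m ≡ 1 (mod 4)`, from the census-internal identities C2a/C2b:
on `m ≡ 1 (mod 8)`: `h₂₈ + h₇ = 4(ν'' + ν')` and `h₂₈ = h₇` give `2ν'' = h₇ - 2ν'`;
on `m ≡ 5 (mod 8)`: `h₂₈ - h₇ = 4(ν'' - ν')` and `h₂₈ = 3h₇` give `2ν'' = h₇ + 2ν'`
(`h₇ = h(-7m)`, `h₂₈ = h(-28m)`, `ν' = ν'₁(-7m)`, `ν'' = ν'₁(-28m)`). -/
theorem R7_conductor_two (h7 h28 ν' ν'' : ℤ) :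
    (h28 + h7 = 4 * (ν'' + ν') → h28 = h7 → 2 * ν'' = h7 - 2 * ν') ∧
    (h28 - h7 = 4 * (ν'' - ν') → h28 = 3 * h7 → 2 * ν'' = h7 + 2 * ν') := by
  constructor <;> intro h1 h2 <;> omega

end Summit.HodgeConjecture.HodgeConjecture.HodgeLocus.Census.Ramified7
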